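import Summits.QuantumFields.YangMills.Theorems.BalabanLadderIRPinnedExit96
import Summits.QuantumFields.YangMills.Theorems.BalabanLadderIRPinnedExitCofinal
import Summits.QuantumFields.YangMills.Theorems.BalabanLadderIRCofinalCouplingsBridge
import Summits.QuantumFields.YangMills.Theorems.BalabanLadderIRColdPurityBridgeRungs
import Summits.QuantumFields.YangMills.Theses.BalabanLadder
import HarnessLib

/-!
# Line `floor-handshake` — COFINAL RE-CUT (rev 3, R423/R424) on the re-typed leaf `BalabanLadder.IRcof`
## crux of record `BalabanLadder.IR` (stmt-QuantumFields-19354) ↦ cofinal leaf `BalabanLadder.IRcof` (stmt-QuantumFields-26930)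

Cell ym-ir, seat ym-ir-idea-6 g3 (lens: finite-size-scaling typed conjectures).  Workfile of the ALTERNATIVE line
`floor-handshake` (census §L row 13); the registry slot on 19354 is the LEAD's (`pinned_exit_96_bill`), untouched.

HONEST FRAMING.  Nothing here proves the Yang–Mills mass gap (Clay), the crux `IR`, its cofinal leaf `IRcof`, or the
existence of a single pure box at weak coupling.  R4 (`BalabanUVStability4`) closes only the conditional finite-𝕋⁴ rung
`BalabanLadder.UV`.  This file is kernel bookkeeping: ONE open stub `H_cof` (the handshake, cofinal in the coupling — the
wall, width 0 on every critic's ledger) plus the residual of record N = `IRnsc` BY NAME; every other statement is proved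
over LANDED theorems.  0 legs discharged.

WHAT CHANGED (R423, 21-frontier APPROVED 2026-08-28T07:42:30Z; R424 executed by the route owner: the spine's `closes` now
consumes `Summit.QuantumFields.YangMills.Theses.BalabanLadder.IRcof`, item stmt-QuantumFields-26930).  The summit owes the
`GapInUnits` clustering family only on SOME set of couplings unbounded above.  Rev 2 of this line closed `IR` modulo
{H = `FloorToPuritySC`, N} (R discharged by `AspectBootstrap.coldDoublingRecursionSC_holds`, p596893; H re-based to the single
tolerance 96 % by `PinnedExit96.rebaseH_iff`, p609285).  Rev 3 relaxes H in EXACTLY ONE quantifier: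

* **H_cof(θ)** `FloorToPurityCofAt θ` (crux, rank 2 — the handshake, cofinal in β): for compact simple SIMPLY-CONNECTED `G`,
  every `r`, every positive-time test function `v`, floor height `ε > 0` and torus threshold `Λ` there are a resolution
  threshold `s₀ > 0` and ONE window factor `k` such that FOR EVERY `β₁` SOME coupling `β ≥ β₁` satisfies, at EVERY spacing
  `0 < s ≤ s₀`: IF the smeared truncated two-point function of the action density is floored, `ε ≤ Q2 G r β L s (Θv) v` on
  all tori `s·L ≥ Λ` (the shape `LowerBounds`(i) supplies at `s = a β`), THEN some torus `L' ∈ [1/s, k/s]`, `L' ≥ 8`, is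
  `θ`-pure, `δᶜ_β(L') ≤ θ`.  Registered at `θ = 1/24`.
  — versus H (`PinnedExit96.FloorToPurityAt θ`): «∃ β₀ ∀ β ≥ β₀» ↦ «∀ β₁ ∃ β ≥ β₁»; the window factor `k` stays UNIFORM (it is
  what turns purity into a gap IN UNITS along the sequence, X-free); the inner «∀ s ≤ s₀» stays (the statement is unit-map
  free; by the choice argument `(∀ σ : ℝ → ℝ, ∃ β ≥ β₁, P β (σ β)) ↔ ¬ ∀ β ≥ β₁, ∃ s, ¬ P β s`, quantifying instead over spacing
  ASSIGNMENTS would give the same statement, so this is the weakest unit-map-free cofinal form).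
  — what it says: along SOME unbounded sequence of couplings the floor scale and the purity scale are comparable within the
  factor `k` — «no strongly-coupled mixed window» is owed cofinally, not at every large β.  The wall is UNCHANGED IN KIND
  (census B7: the pointwise-in-β femto → IR hand-over; it was never a β-transport estimate, so №25 (1) does not discount it).
* **N** `IRnsc` (tree, residual of record BY NAME).

COMPOSITION (all real proofs):  H_cof(1/24) ⇒ PXcof(1/24) (`pinnedExitsCofinal_of_floorToPurityCofAt`: at the good coupling
take `s := a β`, admissible beyond a threshold since `a → 0`; the window IS the pin, `a β · L' ≤ k`) ⇒ with N, `IRcof` BY NAME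
(`IRcof_of_handshake_cof`, through idea-11's landed X-free cofinal kernel `PinnedExitCofinal.cofinalGapOn_of_pinnedExits` on the
simply-connected family and `Y2Bridge.gapOn_univ_of_gapInUnits ∘ N` on the rest) ⇒ `YangMills` with the spine's five other leaves
(`yangMills_of_Hcof`, through the route's own `BalabanLadder.closes`).  Bills compared (PROVED): H ⇒ H_cof (`floorToPurityCofAt_of_at`),
so rev 2's bill {H, N} and the H of record `FloorToPuritySC` still pay (`floorToPurityCof24_of_SC`); H_cof ⇒ PXcof, so this line
is the OBSERVABLE-SIDE supplier of idea-11's `pinned-exit-cofinal` bill {PXcof(1/24), N} (census §L row 37) — it is NOT cheaper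
than PXcof (it implies it); its surplus is FORMAT: H_cof is unit-map free and floor-TRIGGERED (no `LowerBounds`, no `a`, no
`cpLength` in the statement), one implication between two finite-size observables per instance `(β, s)`.

WHY KEEP IT (honest grade: RE-CUT of a priced line; count-neutral; the critics decide).  It is the only bill on the desk whose
open stub mentions neither the unit map nor the floor package: «observable coupling strong at resolution 1/s ⇒ vacuum dominance
at size ≤ k/s», now owed only along a sequence β_n → ∞ of the prover's choosing.  The cofinal freedom is real for THIS stub and
not for PX/E: a proof may pick couplings adapted to the lattice (e.g. β_n with a prescribed floor resolution s_n = 2^{-n}),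
which a «∀ β ≥ β₀» statement forbids.

CHEAPEST FALSIFIER / INSTRUMENT (unchanged instrument I6-5, eng-4 PURITY-TABLE v2 for the purity side; GUIDANCE only): SU(2),
the two-length ratio L_{1/24}(β)/ℓ_ε(β) along β_W ∈ {2.3, …, 2.7}; H_cof dies only if the ratio is unbounded along EVERY
subsequence — strictly harder to kill than H (a kill of H by drift along one sequence leaves H_cof alive iff some other
sequence stays bounded; for a monotone drift both die together).  Teeth: FALSE for `U(1)₄` (Coulomb phase at all β > β_c:
floor at all scales, δᶜ ≡ const > 1/24 — the cofinal quantifier does not help against a PHASE) and for `π₁(G) ≠ 1` (light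
fluxes) — any proof uses non-abelianness and `π₁ = 1` (hence SC + N by name).

RUNGS (by name, landed `ColdPurityBridgeRungs`): `floorToPurity_conclusion_strongCoupling` — H's (hence H_cof's) conclusion
holds floor-free on the strong-coupling window; no weak-coupling rung exists (none does for any line of the census).

DISPROOF USED: none of the recorded `_false_without_` items concerns the β-quantifier; group-blindness and flux kills are
honoured by the binders (simple, simply-connected) and by N.
-/

set_option autoImplicit false

noncomputable section

open Filter Topology MeasureTheory
open scoped SchwartzMap
open Literature.MathematicalPhysics.QuantumFieldTheory Literature.MathematicalPhysics.QuantumLattice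
open Summit.QuantumFields.YangMills.Cruxes.OSLegsFromFemtoAndGap.DlrCollarTransfer (GapInUnits LowerBounds Q2)
open Summit.QuantumFields.YangMills.Cruxes.IR.ColdPressurePincer
open Summit.QuantumFields.YangMills.Cruxes.IR.ColdPurityBridge
open Summit.QuantumFields.YangMills.Cruxes.IR.PinnedExit96
open Summit.QuantumFields.YangMills.Cruxes.OSLegsAtWeakCouplingC.Y2Bridge (gapOn_univ_of_gapInUnits)
open Summit.QuantumFields.YangMills.Theses.BalabanLadder (UV UVSeamRec NT IR IRcof ROT UVOtherGroups)

namespace Summit.QuantumFields.YangMills.Cruxes.IR.FloorHandshakeCofinal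

/-! ## §1 Statements -/

/-- **H_cof(θ) = `FloorToPurityCofAt θ`** — the handshake H (`PinnedExit96.FloorToPurityAt θ`) with the coupling quantifier
made COFINAL: `∃ s₀ k, ∀ β₁ ∃ β ≥ β₁, ∀ s ∈ (0, s₀], floor(β, s) ⇒ ∃ θ-pure cold torus L' ∈ [1/s, k/s]`.  Unit-map free;
simply-connected compact simple `G`.
Why it might fail: a strongly-coupled mixed window (observable coupling `Q2 ≥ ε` at resolution `1/s` while every torus up to
`k/s` is still a mixed thermal state) whose width grows along EVERY sequence β → ∞; FALSE for `U(1)₄` (Coulomb phase) and for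
`π₁(G) ≠ 1` (light fluxes).  Sources: Luscher1983, vanBaalKoller1987, Guth1980, FrohlichSpencer1982,
`Literature.Barriers.QuantumFields.AbelianDeconfinementD4`, census B7. -/
def FloorToPurityCofAt (θ : ℝ) : Prop :=
  ∀ (G : Type) [Group G] [TopologicalSpace G] [IsTopologicalGroup G] [CompactSpace G],
    IsCompactSimpleLieGroup G → SimplyConnectedSpace G →
    letI : MeasurableSpace G := borel G
    haveI : BorelSpace G := ⟨rfl⟩
    ∀ (r : LatticeRep G) (v : 𝓢(EuclideanSpace ℝ (Fin 4), ℝ)),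
      tsupport v ⊆ {y : EuclideanSpace ℝ (Fin 4) | 0 < y 0} →
      ∀ (ε Λ : ℝ), 0 < ε →
        ∃ (s₀ k : ℝ), 0 < s₀ ∧ ∀ β₁ : ℝ, ∃ β : ℝ, β₁ ≤ β ∧ ∀ s : ℝ, 0 < s → s ≤ s₀ →
          (∀ L : ℕ, Λ ≤ s * L → ε ≤ Q2 G r β L s (thetaTest 4 v) v) →
            ∃ L' : ℕ, 8 ≤ L' ∧ 1 / s ≤ (L' : ℝ) ∧ (L' : ℝ) ≤ k / s ∧ coldDefect r.ρ β L' ≤ θ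

/-- The registered instance **H_cof** := `FloorToPurityCofAt (1/24)`. -/
def FloorToPurityCof24 : Prop := FloorToPurityCofAt (1 / 24)

/-- **PXcof(θ) = `PinnedExitsCofinalAt θ`** — VERBATIM line `pinned-exit-cofinal` (ideator ym-ir-idea-11 g0; one item by
normalised signature): under the crux's own hypotheses on the unit map, a pin `T` and, for every `β₁`, SOME `β ≥ β₁` with ONE
cold `4:1` torus `L ≥ 8`, `a(β)·L ≤ T`, `δᶜ_β(L) ≤ θ`. -/
def PinnedExitsCofinalAt (θ : ℝ) : Prop :=
  ∀ (G : Type) [Group G] [TopologicalSpace G] [IsTopologicalGroup G] [CompactSpace G],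
    IsCompactSimpleLieGroup G → SimplyConnectedSpace G →
    letI : MeasurableSpace G := borel G
    haveI : BorelSpace G := ⟨rfl⟩
    ∀ (r : LatticeRep G) (a : ℝ → ℝ), (∀ β, 0 < a β) → Tendsto a atTop (𝓝 0) → LowerBounds G r a →
      ∃ T : ℝ, ∀ β₁ : ℝ, ∃ β : ℝ, β₁ ≤ β ∧ ∃ L : ℕ, 8 ≤ L ∧ a β * (L : ℝ) ≤ T ∧ coldDefect r.ρ β L ≤ θ

/-! ## §2 Registered stubs (sorries live ONLY here) -/

/-- stub **H_cof** (crux, rank 2): `FloorToPurityCofAt (1/24)`.  OPEN — the load-bearing handshake, cofinal in β. -/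
theorem stub_floorToPurityCof : FloorToPurityCofAt (1 / 24) := by
  sorry

/-- stub **N** (RESIDUAL of record, by name): `ColdPressurePincer.IRnsc`. No claim. -/
theorem stub_irnsc : IRnsc := by
  sorry

/-! ## §3 Quantifier bookkeeping (PROVED): H ⇒ H_cof, monotonicity in θ -/

/-- **H(θ) ⇒ H_cof(θ)**: «∀ β ≥ β₀» gives «∀ β₁ ∃ β ≥ β₁» with `β := max β₀ β₁`, same `s₀, k`. -/
theorem floorToPurityCofAt_of_at {θ : ℝ} (hH : FloorToPurityAt θ) : FloorToPurityCofAt θ := by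
  intro G _ _ _ _ hG hsc
  letI : MeasurableSpace G := borel G
  haveI : BorelSpace G := ⟨rfl⟩
  intro r v hv ε Λ hε
  obtain ⟨β₀, s₀, k, hs₀, h⟩ := hH G hG hsc r v hv ε Λ hε
  exact ⟨s₀, k, hs₀, fun β₁ => ⟨max β₀ β₁, le_max_right _ _, h (max β₀ β₁) (le_max_left _ _)⟩⟩

/-- H_cof is monotone in the tolerance. -/
theorem floorToPurityCofAt_mono {θ θ' : ℝ} (hθ : θ ≤ θ') (h : FloorToPurityCofAt θ) : FloorToPurityCofAt θ' := by
  intro G _ _ _ _ hG hsc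
  letI : MeasurableSpace G := borel G
  haveI : BorelSpace G := ⟨rfl⟩
  intro r v hv ε Λ hε
  obtain ⟨s₀, k, hs₀, hcof⟩ := h G hG hsc r v hv ε Λ hε
  refine ⟨s₀, k, hs₀, fun β₁ => ?_⟩
  obtain ⟨β, hβ, hβs⟩ := hcof β₁
  refine ⟨β, hβ, fun s hs hs₀' hfl => ?_⟩
  obtain ⟨L', h8, h1, h2, h3⟩ := hβs s hs hs₀' hfl
  exact ⟨L', h8, h1, h2, h3.trans hθ⟩

/-- **The H of record pays the new bill**: `FloorToPuritySC → H_cof(1/24)` (landed `floorToPurityAt_of_SC`, then §3). -/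
theorem floorToPurityCof24_of_SC (hH : FloorToPuritySC) : FloorToPurityCofAt (1 / 24) :=
  floorToPurityCofAt_of_at (floorToPurityAt_of_SC (by norm_num) hH)

/-! ## §4 H_cof ⇒ PXcof (PROVED): at the good coupling the floor of `LowerBounds` triggers the window, and the window is the pin -/

/-- **H_cof(θ) ⇒ PXcof(θ)** (every θ).  Given `(G, r, a)` with `LowerBounds G r a` = a floor `(v, ε, β₅, Λ₅)` at `s = a β` for
`β ≥ β₅`: H_cof at `(v, ε, Λ₅)` gives `(s₀, k)`; since `a → 0` there is `β_a` with `a β ≤ s₀` beyond it; for any `β₁` ask H_cof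
for a good `β ≥ max β₁ (max β₅ β_a)`; at `s := a β` the floor holds, so a `θ`-pure `L' ≤ k / a β`, i.e. `a β · L' ≤ k =: T`. -/
theorem pinnedExitsCofinal_of_floorToPurityCofAt {θ : ℝ} (hH : FloorToPurityCofAt θ) : PinnedExitsCofinalAt θ := by
  intro G _ _ _ _ hG hsc
  letI : MeasurableSpace G := borel G
  haveI : BorelSpace G := ⟨rfl⟩
  intro r a ha ha0 hlb
  obtain ⟨⟨v, ε, β₅, Λ₅, hv, hε, hfloor⟩, -⟩ := hlb
  obtain ⟨s₀, k, hs₀, hcof⟩ := hH G hG hsc r v hv ε Λ₅ hε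
  obtain ⟨βa, hβa⟩ : ∃ βa : ℝ, ∀ β : ℝ, βa ≤ β → a β ≤ s₀ := by
    have hev : ∀ᶠ β in atTop, a β < s₀ := ha0.eventually (gt_mem_nhds hs₀)
    obtain ⟨βa, h⟩ := Filter.eventually_atTop.1 hev
    exact ⟨βa, fun β hβ => (h β hβ).le⟩
  refine ⟨k, fun β₁ => ?_⟩
  obtain ⟨β, hβ, hβs⟩ := hcof (max β₁ (max β₅ βa))
  have hβ1 : β₁ ≤ β := le_trans (le_max_left _ _) hβ
  have hβ5 : β₅ ≤ β := le_trans ((le_max_left _ _).trans (le_max_right _ _)) hβ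
  have hβa' : βa ≤ β := le_trans ((le_max_right _ _).trans (le_max_right _ _)) hβ
  obtain ⟨L', h8, _h1, h2, h3⟩ := hβs (a β) (ha β) (hβa β hβa') (fun L hL => hfloor β hβ5 L hL)
  refine ⟨β, hβ1, L', h8, ?_, h3⟩
  have h := (le_div_iff₀ (ha β)).1 h2
  simpa [mul_comm] using h

/-! ## §5 The bill (PROVED): H_cof(1/24) ∧ N ⇒ `IRcof` BY NAME; the summit through the route's own `closes` -/

/-- **PXcof(1/24) ∧ N ⇒ `BalabanLadder.IRcof`** (the THESES decl, item stmt-QuantumFields-26930).  Simply-connected `G`: idea-11's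
landed X-free cofinal kernel `PinnedExitCofinal.cofinalGapOn_of_pinnedExits` (exit set ∋ the pinned pure couplings, cofinal;
per-β widening `coldPressureAt_widen_24`, rate seam on the set); other simple `G`: N gives `GapInUnits`, restricted to `univ`. -/
theorem ircof_of_pinnedExitsCofinal24 (hP : PinnedExitsCofinalAt (1 / 24)) (hN : IRnsc) : IRcof := by
  intro G _ _ _ _ hG
  letI : MeasurableSpace G := borel G
  haveI : BorelSpace G := ⟨rfl⟩
  intro r a ha ha0 hlb
  by_cases hsc : SimplyConnectedSpace G
  · obtain ⟨T, hcof⟩ := hP G hG hsc r a ha ha0 hlb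
    exact Summit.QuantumFields.YangMills.Cruxes.IR.PinnedExitCofinal.cofinalGapOn_of_pinnedExits r a ha ha0 hcof
  · exact ⟨Set.univ, fun x => ⟨x, Set.mem_univ _, le_rfl⟩, gapOn_univ_of_gapInUnits r a (hN G hG hsc r a ha ha0 hlb)⟩

/-- **THE BILL OF THIS LINE (PROVED): `H_cof(1/24) → N → IRcof` BY NAME.** -/
theorem IRcof_of_handshake_cof (hH : FloorToPurityCofAt (1 / 24)) (hN : IRnsc) : IRcof :=
  ircof_of_pinnedExitsCofinal24 (pinnedExitsCofinal_of_floorToPurityCofAt hH) hN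

/-- Proof-of-item shape: the re-typed leaf from the two registered stubs. -/
theorem IRcof_of_stubs : IRcof := IRcof_of_handshake_cof stub_floorToPurityCof stub_irnsc

/-- **Summit probe (PROVED over the route file): the spine's `closes` with this line's bill in the `IRcof` slot.** -/
theorem yangMills_of_Hcof (hUV : UV) (hSeam : UVSeamRec) (hNT : NT) (hH : FloorToPurityCofAt (1 / 24)) (hN : IRnsc)
    (hROT : ROT) (hOther : UVOtherGroups) : YangMills :=
  Summit.QuantumFields.YangMills.Theses.BalabanLadder.closes hUV hSeam hNT (IRcof_of_handshake_cof hH hN) hROT hOther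

/-! ## §6 Relations to the bills of record (PROVED) -/

/-- Rev 2's bill still pays: `H(1/24) → N → IRcof` (H ⇒ H_cof). -/
theorem IRcof_of_H24 (hH : FloorToPurityAt (1 / 24)) (hN : IRnsc) : IRcof :=
  IRcof_of_handshake_cof (floorToPurityCofAt_of_at hH) hN

/-- The H of record pays: `FloorToPuritySC → N → IRcof`. -/
theorem IRcof_of_SC (hH : FloorToPuritySC) (hN : IRnsc) : IRcof :=
  IRcof_of_handshake_cof (floorToPurityCof24_of_SC hH) hN

/-- `IR → IRcof` by name (take all couplings; the leaf of record implies the re-typed leaf). -/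
theorem IRcof_of_IR (h : IR) : IRcof := by
  intro G _ _ _ _ hG
  letI : MeasurableSpace G := borel G
  haveI : BorelSpace G := ⟨rfl⟩
  intro r a ha ha0 hlb
  exact ⟨Set.univ, fun x => ⟨x, Set.mem_univ _, le_rfl⟩, gapOn_univ_of_gapInUnits r a (h G hG r a ha ha0 hlb)⟩

/-! ## §7 Rung (by name): H_cof's conclusion on the strong-coupling window, floor-free -/

section Rung

variable {G : Type} [Group G] [TopologicalSpace G] [IsTopologicalGroup G] [CompactSpace G]
  [MeasurableSpace G] [BorelSpace G]

/-- On `0 ≤ β ≤ strongCouplingRadius ρ` every admissible spacing window `[1/s, k/s]` with `k ≥ 16` contains a `1/24`-pure cold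
torus, FLOOR-FREE — H_cof's conclusion is free at strong coupling exactly as H's (landed `coldExit_uniform_of_strongCoupling`:
purity at every multiple `8k₁ n`). Stated as the existence of a pure torus in every octave beyond `8k₁`. -/
theorem conclusion_strongCoupling (r : LatticeRep G) :
    ∃ k₁ : ℕ, 1 ≤ k₁ ∧ ∀ β : ℝ, 0 ≤ β →
      β ≤ Literature.MathematicalPhysics.QuantumFieldTheory.Balaban1983to89.Missing.strongCouplingRadius r.ρ →
        ∀ n : ℕ, k₁ ≤ n → coldDefect r.ρ β (8 * n) ≤ 1 / 24 := by
  obtain ⟨k₁, hk₁, h⟩ := coldExit_uniform_of_strongCoupling r (show (0 : ℝ) < 1 / 24 by norm_num)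
  exact ⟨k₁, hk₁, fun β hβ0 hβ n hn => h β hβ0 hβ n hn⟩

end Rung

end Summit.QuantumFields.YangMills.Cruxes.IR.FloorHandshakeCofinal

end
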